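import Summits.BirchSwinnertonDyer.Rank1Residual.X10.SurjThreePerPairFlagFree
import Summits.BirchSwinnertonDyer.Rank1Residual.GaloisImage.FrobeniusOrderWitness
import HarnessLib

/-!
# Class X10a′ / row D3 (good ordinary at `3`, `ρ̄_{E,3}` SURJECTIVE) PER PAIR with the mod-`3` IMAGE DECIDED IN
# THE KERNEL: the flag-free, class-free record shapes of `X10/SurjThreePerPairFlagFree` with the census binder
# `hsurj : Surj W 3` DISCHARGED by two Frobenius witnesses read off the literal model (unit x11c's
# `GaloisImage.hasSurjectiveModNGaloisRep_of_intModel_of_irr_of_order`, Serre 1972 Prop. 15 at `p = 3`)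
# (cell `b2b-bsdres`, unit `b2b-bsdres-x10` = X10 / N2 class lead, GEN 42; TOOL — theorems only, no definition,
# no named fact, nothing booked)

HONEST FRAMING (run/shared/lean/b2b/bsd-rank1-residual/, verbatim in every file): the goal of the
cell is to DELETE the COMBINATION-SHAPED residual classes of the Birch–Swinnerton-Dyer formula for
ALL analytic-rank `≤ 1` elliptic curves over `ℚ` — "full BSD formula for every rank `≤ 1` curve in
class `C`" assembled STRICTLY from published theorems — so that the rank-`≤ 1` remainder becomes
exactly the CONSTRUCTION-SHAPED classes, which are TYPED (missing-input `Prop`s), NOT attempted.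
This is not "finishing BSD".  X10a′ = X10 ∧ surj(3) is CLOSED (PUB*) AS A CLASS by Yan–Zhu 2026 Thm. 4.15
under the register flag `YZ26@3-BF-ERL-Ohta` (row D3, 5 437 classes; PARTITION-SCOREBOARD v1.25); THIS FILE books
nothing and touches no class statement.  PARTITION (D-0054): D3 / X10a′ × p = 3 — types-the-object-of; closes NONE.

## What (x10 GEN 42, X10-AUDIT §48; corrects `class-closure/N2/D3-PERPAIR-SPEC-x10g41.md` §4 (c))

GEN 41's D3 spec said a kernel image certificate at `p = 3` was «NOT in the tree as a decision procedure» and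
displayed `hsurj : Surj W 3` as a census datum.  That was wrong: unit x11c's
`GaloisImage/FrobeniusOrderWitness.lean` (gen 6) proves `ρ̄_{E,p}` onto, at ANY prime `p`, from TWO Frobenius
witnesses read off an integer model — (i) a good `ℓ₁ ≠ p` with `X² − a_{ℓ₁}X + ℓ₁` irreducible mod `p` (image in
no Borel), (ii) a good `ℓ₂ ≠ p` with `ℓ₂ ≡ 1`, `a_{ℓ₂} ≡ 2 (mod p)` and `p² ∤ #Ẽ(𝔽_{ℓ₂})` (a TRANSVECTION in the
image: the Frobenius is `≠ 1` on `E[p]` because `E[p] ↪ Ẽ(𝔽_{ℓ₂})` would force `p² ∣ #Ẽ(𝔽_{ℓ₂})`; Serre's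
Prop. 15 + `det = χ̄_p` onto) — and team n1011 uses it per cell at `p = 3` (`surj3_frob_v<L>`,
`GaloisImage/ThreeAdicTowerBetaSurjInstances*`).  Hence, in the record vocabulary of this topic (`countPoints`,
`discOf`, `decide`):

* `MuZeroRoad.surj_three_of_ainvs_of_witnesses` — bookkeeping: `Surj W 3` for a curve given by a literal integer
  model from `ℓ₁ ∤ 6Δ`, `countPoints … ℓ₁ = n₁`, `X² − (ℓ₁+1−n₁)X + ℓ₁` root-free mod `3` (the SAME witness the
  cell's records already carry for irreducibility) and `ℓ₂ ∤ 6Δ`, `countPoints … ℓ₂ = n₂`, `ℓ₂ ≡ 1`,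
  `ℓ₂ + 1 − n₂ ≡ 2 (mod 3)`, `9 ∤ n₂`;
* **`MuZeroRoad.bsdp_three_rankZero_of_ainvs_of_surjWitnesses_of_wuthrich_of_shaAn_unit`** — X10a′ ∩ {r = 0}
  per pair: Wuthrich 2014 Prop. 21 (`hW`, A6) + GZK (A18) + census `hL` (`L(E,1) ≠ 0`), `hunit` (`3 ∤ #Ш_an`)
  ⟹ Miller's `BSD(E,3)`, with good reduction at `3` AND surjectivity DECIDED in the kernel — NO image datum
  displayed, NO certificate beyond the census, NO Kato, NO Yan–Zhu;
* **`MuZeroRoad.bsdp_three_rankOne_of_ainvs_of_surjWitnesses_of_kato_of_shaAn_unit`** — X10a′ ∩ {r = 1} per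
  pair: Kato Thm. 17.4 (`hkato`, uniform shape) + `hS` (A35) + `hPR` (F39) + `hmodP` (A19) + `hGZK` (A18) + `h3`
  (A25) + census `hr1` + the Schneider `3`-adic height certificate `hSch` + `hunit` ⟹ `BSD(E,3)`, good ORDINARY at
  `3` and surjectivity decided in the kernel; `…_of_fine_…` the same with Kato 17.4 from F1.

So a D3 cell of analytic rank `0` with `3 ∤ #Ш_an` closes per pair from its Cremona model + four point counts +
the census words `L(E,1) ≠ 0`, `3 ∤ #Ш_an` and the two refereed-in-print facts A6, A18 — nothing else.

References: J.-P. Serre, Invent. Math. 15 (1972) §2.4 Prop. 15, §2.8, §5.2 (iii) [Serre1972]; C. Wuthrich,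
Doc. Math. 19 (2014) Lemma 20, Prop. 21 [Wuthrich2014]; K. Kato, Astérisque 295 (2004) Thm. 17.4 (3)
[Kato2004Asterisque]; B. Mazur, Invent. Math. 44 (1978) Prop. 6.3 (1) [Mazur1978]; J. H. Silverman, AEC (2009)
VII.2.1, VII.3.1 (b), VII.4.1 (a) [SilvermanAEC2009]; R. L. Miller, LMS J. Comput. Math. 14 (2011) Def. 1.1
[Miller2011LMS].
-/

set_option autoImplicit false

noncomputable section

open scoped Classical MatrixGroups ModularForm

open CongruenceSubgroup WeierstrassCurve Field Literature.NumberTheory.GaloisRepresentations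
  Literature.NumberTheory.GaloisCohomology Literature.NumberTheory.EllipticCurves
  Literature.NumberTheory.EllipticCurves.ModularForms Literature.NumberTheory.EllipticCurves.Rank1Residual
  Literature.NumberTheory.EllipticCurves.Rank1Residual.Typed
  Literature.NumberTheory.EllipticCurves.Wuthrich2014
  Literature.NumberTheory.EllipticCurves.Kato2004 Literature.NumberTheory.EllipticCurves.Kato2004.EulerSystemValues
  Literature.NumberTheory.EllipticCurves.Rank1Residual.X11RankOneCertificates
  Summit.BirchSwinnertonDyer.BirchSwinnertonDyer.Rank1Residual.IntModel
  Summit.BirchSwinnertonDyer.BirchSwinnertonDyer.Rank1Residual.X11RankOne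
  Summit.BirchSwinnertonDyer.BirchSwinnertonDyer.Theorems.Rank1ResidualX1Defs
  Summit.BirchSwinnertonDyer.BirchSwinnertonDyer.Rank1Residual
  Summit.BirchSwinnertonDyer.Rank1Residual.GaloisImage

namespace Summit.BirchSwinnertonDyer.Rank1Residual.X10.MuZeroRoad

/-- **`ρ̄_{E,3}` is onto, read off a literal integer model by two Frobenius witnesses** (the record-vocabulary
form of x11c's `hasSurjectiveModNGaloisRep_of_intModel_of_irr_of_order` at `p = 3`): `ℓ₁ ∤ 6Δ` with
`countPoints [a₁,…,a₆] ℓ₁ = n₁` and `X² − (ℓ₁+1−n₁)X + ℓ₁` root-free mod `3` (no Borel contains the image), and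
`ℓ₂ ∤ 6Δ` with `countPoints [a₁,…,a₆] ℓ₂ = n₂`, `ℓ₂ ≡ 1`, `a_{ℓ₂} = ℓ₂ + 1 − n₂ ≡ 2 (mod 3)`, `9 ∤ n₂` (the
Frobenius at `ℓ₂` is a transvection: `3 ∣ #G`); Serre's Prop. 15 and `det = χ̄₃` onto give `G = GL₂(𝔽₃)`.
All hypotheses are `decide`d per cell. [cite: Serre1972, §2.4 Prop. 15, §2.8 Prop. 19 a), §5.2 (iii)]
[cite: SilvermanAEC2009, Prop. VII.3.1 (b) and Prop. VII.4.1 (a)] -/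
theorem surj_three_of_ainvs_of_witnesses (a1 a2 a3 a4 a6 : ℤ) {W : WeierstrassCurve ℚ}
    [W.IsElliptic] [W.IsGloballyMinimal] (hW : integralModelInt W = ⟨a1, a2, a3, a4, a6⟩)
    (ℓ₁ n₁ ℓ₂ n₂ : ℕ) [Fact ℓ₁.Prime] [Fact ℓ₂.Prime]
    (hℓ₁2 : ℓ₁ ≠ 2) (hℓ₁3 : ℓ₁ ≠ 3) (hℓ₁Δ : ¬ (ℓ₁ : ℤ) ∣ discOf [a1, a2, a3, a4, a6])
    (hc₁ : countPoints [a1, a2, a3, a4, a6] ℓ₁ = n₁)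
    (hnoroot : ∀ t : ℕ, t < 3 → ¬ (3 : ℤ) ∣ (t : ℤ) ^ 2 - ((ℓ₁ : ℤ) + 1 - n₁) * t + ℓ₁)
    (hℓ₂2 : ℓ₂ ≠ 2) (hℓ₂3 : ℓ₂ ≠ 3) (hℓ₂Δ : ¬ (ℓ₂ : ℤ) ∣ discOf [a1, a2, a3, a4, a6])
    (hc₂ : countPoints [a1, a2, a3, a4, a6] ℓ₂ = n₂)
    (hdet₂ : (ℓ₂ : ZMod 3) = 1) (htr₂ : (((ℓ₂ : ℤ) + 1 - n₂ : ℤ) : ZMod 3) = 2) (hsq : ¬ 9 ∣ n₂) :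
    W.HasSurjectiveModNGaloisRep 3 := by
  haveI : Fact (Nat.Prime 3) := ⟨by norm_num⟩
  have hΔ : (⟨a1, a2, a3, a4, a6⟩ : WeierstrassCurve ℤ).Δ = discOf [a1, a2, a3, a4, a6] :=
    intCurve_Δ a1 a2 a3 a4 a6
  have hcard₁ : Nat.card (((⟨a1, a2, a3, a4, a6⟩ : WeierstrassCurve ℤ).map
      (Int.castRingHom (ZMod ℓ₁))).toAffine.Point) = n₁ := by
    have h := X11b.natCard_point_eq_countPoints a1 a2 a3 a4 a6 ℓ₁ hℓ₁2 (by rw [hΔ]; exact hℓ₁Δ)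
    rw [hc₁] at h
    exact_mod_cast h
  have hcard₂ : Nat.card (((⟨a1, a2, a3, a4, a6⟩ : WeierstrassCurve ℤ).map
      (Int.castRingHom (ZMod ℓ₂))).toAffine.Point) = n₂ := by
    have h := X11b.natCard_point_eq_countPoints a1 a2 a3 a4 a6 ℓ₂ hℓ₂2 (by rw [hΔ]; exact hℓ₂Δ)
    rw [hc₂] at h
    exact_mod_cast h
  refine hasSurjectiveModNGaloisRep_of_intModel_of_irr_of_order hW 3 ℓ₁ ℓ₂ hℓ₁3 hℓ₂3
    (by rw [hΔ]; exact hℓ₁Δ) (by rw [hΔ]; exact hℓ₂Δ) hcard₁ hcard₂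
    (forall_zmod_of_forall_lt fun t ht h0 ↦ hnoroot t ht ?_) hdet₂ htr₂ (by norm_num; exact hsq)
  change ((3 : ℕ) : ℤ) ∣ _
  rw [← ZMod.intCast_zmod_eq_zero_iff_dvd]
  push_cast at h0 ⊢
  linear_combination h0

/-- **X10a′ ∩ {r = 0} record shape with the IMAGE DECIDED IN THE KERNEL: Wuthrich Prop. 21 ∧ `L(E,1) ≠ 0` ∧
`ord₃ #Ш_an = 0` ⟹ Miller's `BSD(E,3)` for a cell given by a literal integer model** — good reduction at `3`
from `3 ∤ Δ`; `ρ̄_{E,3}` onto from the two Frobenius witnesses of `surj_three_of_ainvs_of_witnesses`; displayed: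
PUBLISHED `hW` (A6), `hGZK` (A18); census `hL`, `hunit`.  NO image datum, NO certificate beyond the census, NO
Kato, NO Yan–Zhu; FLAG-FREE; per pair; nothing booked. [cite: Wuthrich2014, Prop. 21 (p. 400)]
[cite: Serre1972, §2.4 Prop. 15, §2.8] [cite: Miller2011LMS, Def. 1.1 (arXiv:1010.2431 p. 3)] -/
theorem bsdp_three_rankZero_of_ainvs_of_surjWitnesses_of_wuthrich_of_shaAn_unit
    (hWu : Wuthrich2014.sha_dvd_analyticSha) (hGZK : rank_eq_analyticRank_of_analyticRank_le_one)
    (a1 a2 a3 a4 a6 : ℤ) {W : WeierstrassCurve ℚ} [W.IsElliptic] [W.IsGloballyMinimal]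
    (hW : integralModelInt W = ⟨a1, a2, a3, a4, a6⟩)
    (ℓ₁ n₁ ℓ₂ n₂ : ℕ) [Fact ℓ₁.Prime] [Fact ℓ₂.Prime]
    (h3Δ : ¬ (3 : ℤ) ∣ discOf [a1, a2, a3, a4, a6])
    (hℓ₁2 : ℓ₁ ≠ 2) (hℓ₁3 : ℓ₁ ≠ 3) (hℓ₁Δ : ¬ (ℓ₁ : ℤ) ∣ discOf [a1, a2, a3, a4, a6])
    (hc₁ : countPoints [a1, a2, a3, a4, a6] ℓ₁ = n₁)
    (hnoroot : ∀ t : ℕ, t < 3 → ¬ (3 : ℤ) ∣ (t : ℤ) ^ 2 - ((ℓ₁ : ℤ) + 1 - n₁) * t + ℓ₁)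
    (hℓ₂2 : ℓ₂ ≠ 2) (hℓ₂3 : ℓ₂ ≠ 3) (hℓ₂Δ : ¬ (ℓ₂ : ℤ) ∣ discOf [a1, a2, a3, a4, a6])
    (hc₂ : countPoints [a1, a2, a3, a4, a6] ℓ₂ = n₂)
    (hdet₂ : (ℓ₂ : ZMod 3) = 1) (htr₂ : (((ℓ₂ : ℤ) + 1 - n₂ : ℤ) : ZMod 3) = 2) (hsq : ¬ 9 ∣ n₂)
    (hL : W.entireLFunction 1 ≠ 0)
    (hunit : ∃ q : ℚ, shaAn W = (q : ℂ) ∧ padicValRat 3 q = 0) : BSDp W 3 := by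
  haveI : Fact (Nat.Prime 3) := ⟨by norm_num⟩
  have hgood : W.HasGoodReductionAtPrime 3 :=
    hasGoodReductionAtPrime_of_not_dvd W 3 (by rw [minimalDiscriminantInt_eq hW, intCurve_Δ]; exact h3Δ)
  exact bsdp_three_rankZero_surj_of_wuthrich_of_shaAn_unit W hWu hGZK hgood
    (surj_three_of_ainvs_of_witnesses a1 a2 a3 a4 a6 hW ℓ₁ n₁ ℓ₂ n₂ hℓ₁2 hℓ₁3 hℓ₁Δ hc₁ hnoroot hℓ₂2 hℓ₂3
      hℓ₂Δ hc₂ hdet₂ htr₂ hsq) hL hunit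

/-- **X10a′ ∩ {r = 1} record shape with the IMAGE DECIDED IN THE KERNEL: Kato 17.4 ∧ Schneider certificate ∧
`ord₃ #Ш_an = 0` ⟹ Miller's `BSD(E,3)` for a cell given by a literal integer model** — good ORDINARY at `3`
(`3 ∤ Δ`, `countPoints … 3 = n₃`, `3 ∤ 4 − n₃`) and `ρ̄_{E,3}` onto (two Frobenius witnesses) READ OFF the model;
displayed: `hkato` (Kato 17.4, uniform shape; clause (3) on the good-ordinary tower), PUBLISHED `hS` `hPR` `hmodP`
`hGZK` `h3`, census `hr1`, certificates `hSch` (THE canonical cyclotomic `3`-adic height non-degenerate), `hunit`.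
NO image datum; FLAG-FREE; per pair; nothing booked. [cite: Kato2004Asterisque, Thm. 17.4 (3) (p. 273)]
[cite: Wuthrich2014, Lemma 20 (p. 399)] [cite: PerrinRiou1987, §1.4 Cor. 1.8] [cite: Serre1972, §2.4 Prop. 15, §2.8]
[cite: Miller2011LMS, Def. 1.1 (arXiv:1010.2431 p. 3)] -/
theorem bsdp_three_rankOne_of_ainvs_of_surjWitnesses_of_kato_of_shaAn_unit
    (hkato : ∀ (W : WeierstrassCurve ℚ) [W.IsElliptic] [W.IsGloballyMinimal] (p : ℕ) [Fact p.Prime]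
      (κ : ZpExtension ℚ p) (γ : Field.absoluteGaloisGroup ℚ) (N : ℕ) [NeZero N]
      (f : CuspForm (Gamma0 N) 2), kato_divisibility W p (κ := κ) (γ := γ) (f := f))
    (hS : Schneider1985_order_charGenerator_odd) (hPR : perrinRiou_rankOne_leadingTerms_odd)
    (hmodP : nonempty_modularParametrizationData)
    (hGZK : rank_eq_analyticRank_of_analyticRank_le_one)
    (h3 : realPeriodRat_eq_unit_mul_plusPeriod_three)
    (a1 a2 a3 a4 a6 : ℤ) {W : WeierstrassCurve ℚ} [W.IsElliptic] [W.IsGloballyMinimal]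
    (hW : integralModelInt W = ⟨a1, a2, a3, a4, a6⟩)
    (ℓ₁ n₁ ℓ₂ n₂ n3 : ℕ) [Fact ℓ₁.Prime] [Fact ℓ₂.Prime]
    (h3Δ : ¬ (3 : ℤ) ∣ discOf [a1, a2, a3, a4, a6])
    (hc3 : countPoints [a1, a2, a3, a4, a6] 3 = n3) (hord3 : ¬ (3 : ℤ) ∣ (3 : ℤ) + 1 - n3)
    (hℓ₁2 : ℓ₁ ≠ 2) (hℓ₁3 : ℓ₁ ≠ 3) (hℓ₁Δ : ¬ (ℓ₁ : ℤ) ∣ discOf [a1, a2, a3, a4, a6])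
    (hc₁ : countPoints [a1, a2, a3, a4, a6] ℓ₁ = n₁)
    (hnoroot : ∀ t : ℕ, t < 3 → ¬ (3 : ℤ) ∣ (t : ℤ) ^ 2 - ((ℓ₁ : ℤ) + 1 - n₁) * t + ℓ₁)
    (hℓ₂2 : ℓ₂ ≠ 2) (hℓ₂3 : ℓ₂ ≠ 3) (hℓ₂Δ : ¬ (ℓ₂ : ℤ) ∣ discOf [a1, a2, a3, a4, a6])
    (hc₂ : countPoints [a1, a2, a3, a4, a6] ℓ₂ = n₂)
    (hdet₂ : (ℓ₂ : ZMod 3) = 1) (htr₂ : (((ℓ₂ : ℤ) + 1 - n₂ : ℤ) : ZMod 3) = 2) (hsq : ¬ 9 ∣ n₂)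
    (hr1 : W.analyticRank = 1)
    (hSch : ∀ Dh : PAdicHeightData W 3, Dh.IsCanonical → SchneiderConjecture Dh)
    (hunit : ∃ q : ℚ, shaAn W = (q : ℂ) ∧ padicValRat 3 q = 0) : BSDp W 3 := by
  haveI : Fact (Nat.Prime 3) := ⟨by norm_num⟩
  obtain ⟨hgood, hord, -⟩ := goodOrdIrr_three_of_ainvs_of_countPoints a1 a2 a3 a4 a6 hW ℓ₁ n₁ n3 h3Δ hc3
    hord3 hℓ₁2 hℓ₁3 hℓ₁Δ hc₁ hnoroot
  exact bsdp_three_rankOne_surj_of_kato_of_schneider_of_shaAn_unit W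
    (fun κ γ _ f ↦ hkato W 3 κ γ (W.conductorNorm ℤ) f) hS hPR hmodP hGZK h3 hgood hord
    (surj_three_of_ainvs_of_witnesses a1 a2 a3 a4 a6 hW ℓ₁ n₁ ℓ₂ n₂ hℓ₁2 hℓ₁3 hℓ₁Δ hc₁ hnoroot hℓ₂2 hℓ₂3
      hℓ₂Δ hc₂ hdet₂ htr₂ hsq) hr1 hSch hunit

/-- **The same rank-`1` record shape with Kato's Thm. 17.4 at the pair DERIVED from F1**
(`kato_divisibility_three_of_fine`). [cite: Kato2004Asterisque, Thm. 12.6 (p. 222), Thm. 17.4 (3) (p. 273) and §17.13] -/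
theorem bsdp_three_rankOne_of_ainvs_of_surjWitnesses_of_fine_of_shaAn_unit
    (hfine : exists_divisibilityInputs_fineQuotient_zeta)
    (hS : Schneider1985_order_charGenerator_odd) (hPR : perrinRiou_rankOne_leadingTerms_odd)
    (hmodP : nonempty_modularParametrizationData)
    (hGZK : rank_eq_analyticRank_of_analyticRank_le_one)
    (h3 : realPeriodRat_eq_unit_mul_plusPeriod_three)
    (a1 a2 a3 a4 a6 : ℤ) {W : WeierstrassCurve ℚ} [W.IsElliptic] [W.IsGloballyMinimal]
    (hW : integralModelInt W = ⟨a1, a2, a3, a4, a6⟩)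
    (ℓ₁ n₁ ℓ₂ n₂ n3 : ℕ) [Fact ℓ₁.Prime] [Fact ℓ₂.Prime]
    (h3Δ : ¬ (3 : ℤ) ∣ discOf [a1, a2, a3, a4, a6])
    (hc3 : countPoints [a1, a2, a3, a4, a6] 3 = n3) (hord3 : ¬ (3 : ℤ) ∣ (3 : ℤ) + 1 - n3)
    (hℓ₁2 : ℓ₁ ≠ 2) (hℓ₁3 : ℓ₁ ≠ 3) (hℓ₁Δ : ¬ (ℓ₁ : ℤ) ∣ discOf [a1, a2, a3, a4, a6])
    (hc₁ : countPoints [a1, a2, a3, a4, a6] ℓ₁ = n₁)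
    (hnoroot : ∀ t : ℕ, t < 3 → ¬ (3 : ℤ) ∣ (t : ℤ) ^ 2 - ((ℓ₁ : ℤ) + 1 - n₁) * t + ℓ₁)
    (hℓ₂2 : ℓ₂ ≠ 2) (hℓ₂3 : ℓ₂ ≠ 3) (hℓ₂Δ : ¬ (ℓ₂ : ℤ) ∣ discOf [a1, a2, a3, a4, a6])
    (hc₂ : countPoints [a1, a2, a3, a4, a6] ℓ₂ = n₂)
    (hdet₂ : (ℓ₂ : ZMod 3) = 1) (htr₂ : (((ℓ₂ : ℤ) + 1 - n₂ : ℤ) : ZMod 3) = 2) (hsq : ¬ 9 ∣ n₂)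
    (hr1 : W.analyticRank = 1)
    (hSch : ∀ Dh : PAdicHeightData W 3, Dh.IsCanonical → SchneiderConjecture Dh)
    (hunit : ∃ q : ℚ, shaAn W = (q : ℂ) ∧ padicValRat 3 q = 0) : BSDp W 3 := by
  haveI : Fact (Nat.Prime 3) := ⟨by norm_num⟩
  obtain ⟨hgood, hord, -⟩ := goodOrdIrr_three_of_ainvs_of_countPoints a1 a2 a3 a4 a6 hW ℓ₁ n₁ n3 h3Δ hc3
    hord3 hℓ₁2 hℓ₁3 hℓ₁Δ hc₁ hnoroot
  exact bsdp_three_rankOne_surj_of_fine_of_schneider_of_shaAn_unit W hfine hS hPR hmodP hGZK h3 hgood hord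
    (surj_three_of_ainvs_of_witnesses a1 a2 a3 a4 a6 hW ℓ₁ n₁ ℓ₂ n₂ hℓ₁2 hℓ₁3 hℓ₁Δ hc₁ hnoroot hℓ₂2 hℓ₂3
      hℓ₂Δ hc₂ hdet₂ htr₂ hsq) hr1 hSch hunit


/-! ### Format instance (NOT a booking, NOT a D3-membership claim): `11a1` at `p = 3` -/

/-- **`BSD(E,3)` AT THE PAIR `(11a1, 3)` from Wuthrich Prop. 21 + GZK + the census words `L(E,1) ≠ 0`,
`3 ∤ #Ш_an`, with good reduction at `3` AND `ρ̄_{E,3}` onto DECIDED IN THE KERNEL** — format instance of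
`bsdp_three_rankZero_of_ainvs_of_surjWitnesses_of_wuthrich_of_shaAn_unit` on Cremona's `11a1 = [0, −1, 1, −10, −20]`
(`N = 11`, `Δ = −11⁵`): irreducibility witness `ℓ₁ = 5` (`#Ẽ(𝔽₅) = 5`, `a₅ = 1`, `X² − X + 5` root-free mod `3`),
transvection witness `ℓ₂ = 67` (`#Ẽ(𝔽₆₇) = 75`, `a₆₇ = −7 ≡ 2`, `67 ≡ 1 (mod 3)`, `9 ∤ 75`).  The pair `(11a1, 3)`
is covered in the census by other roads; this theorem only shows the shape elaborates on a literal model with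
four `decide`d point-count facts.  Nothing booked. [cite: Wuthrich2014, Prop. 21 (p. 400)]
[cite: Serre1972, §2.4 Prop. 15, §2.8] [cite: Cremona2006, Table 1 (Cremona label 11a1)] -/
theorem bsdp_three_e11a1_of_surjWitnesses
    (hWu : Wuthrich2014.sha_dvd_analyticSha) (hGZK : rank_eq_analyticRank_of_analyticRank_le_one)
    (W : WeierstrassCurve ℚ) [W.IsElliptic] [W.IsGloballyMinimal]
    (hI : integralModelInt W = ⟨0, -1, 1, -10, -20⟩) (hL : W.entireLFunction 1 ≠ 0)
    (hunit : ∃ q : ℚ, shaAn W = (q : ℂ) ∧ padicValRat 3 q = 0) : BSDp W 3 :=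
  haveI : Fact (Nat.Prime 5) := ⟨by norm_num⟩
  haveI : Fact (Nat.Prime 67) := ⟨by norm_num⟩
  bsdp_three_rankZero_of_ainvs_of_surjWitnesses_of_wuthrich_of_shaAn_unit hWu hGZK 0 (-1) 1 (-10) (-20) hI
    5 5 67 75 (by decide +kernel) (by decide) (by decide) (by decide +kernel) (by decide +kernel)
    (by decide +kernel) (by decide) (by decide) (by decide +kernel) (by decide +kernel) (by decide) (by decide)
    (by decide) hL hunit

end Summit.BirchSwinnertonDyer.Rank1Residual.X10.MuZeroRoad

end
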